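import Summits.Ventures.PercRepro.C025ProfileRankFourFacts

/-!
# The rank-4 certificate: (Dem)(c) — a pair on a three-point line receives its demand (night-3 g8)

NIGHT3-G7-RANK4-CERTIFICATE.md §2(c), in the kernel: for a pair `B` (`|B| = 2`) with `j(B) = 1` — its line `cl B` is
`B ∪ {z}` — and `p := ρ(E∖B) ≥ 3`, the supersets pay at least `p`: with `F := E ∖ cl B`, every `B ∪ {y}` (`y ∈ F`) pays
exactly `1`; if `|F| ≥ p` this is enough; otherwise `|F| = p − 1` (submodularity: `p ≤ ρ(F) + 1`), `F` is independent,
and every four-set `B ∪ {z, y}` (`y ∈ F`) has complement `F ∖ {y}` of rank `p − 2`, hence pays `1/(p − 1)`; the total is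
`(p − 1) + (p − 1)/(p − 1) = p`. Neither a rank-4 hypothesis nor simplicity is needed: the statement holds in every
finite matroid.
-/

open scoped Matroid

namespace PercRepro

open Set Finset ThmH

section DemC

variable {α : Type} [DecidableEq α] {M : Matroid α} [M.Finite]

/-- **(Dem)(c)**: in every finite matroid, a pair `B` whose line has exactly one further point (`j(B) = 1`) with
`ρ(E∖B) ≥ 3` receives at least `ρ(E∖B)` under `w4n` (no simplicity is needed for this case). -/
theorem dem_w4n_of_jB_eq_one {B : Finset α}
    (hB : B ∈ Profile.Rq M 2) (hBc : B.card = 2) (hj : jB M B = 1) (hp : 3 ≤ crk M B) :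
    (crk M B : ℚ) ≤ ∑ S ∈ (Shadow.levelSet M 3).filter (fun S => B ⊆ S), w4n M B S := by
  classical
  rw [Profile.mem_Rq] at hB
  obtain ⟨hBg, hB2⟩ := hB
  set L := clF M B with hL
  set F := gr M \ L with hF
  set T := L \ B with hT
  set p := crk M B with hpdef
  have hBL : B ⊆ L := subset_clF_self hBg
  have hLg : L ⊆ gr M := clF_subset_gr B
  have hFT : gr M \ B = F ∪ T := gr_sdiff_eq_union hBg
  -- the line has exactly one point outside B
  have hTcard : T.card = 1 := by
    have hc : (clF M B \ B).card = (clF M B).card - B.card := Finset.card_sdiff_of_subset (subset_clF_self hBg)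
    unfold jB at hj
    rw [hT, hL, hc]
    omega
  obtain ⟨z, hTz⟩ := Finset.card_eq_one.1 hTcard
  have hzT : z ∈ T := by rw [hTz]; exact Finset.mem_singleton_self z
  have hzL : z ∈ L := (Finset.mem_sdiff.1 hzT).1
  have hzB : z ∉ B := (Finset.mem_sdiff.1 hzT).2
  have hzg : z ∈ gr M := hLg hzL
  have hLeq : L = insert z B := by
    ext x
    rw [Finset.mem_insert]
    constructor
    · intro hx
      by_cases hxB : x ∈ B
      · exact Or.inr hxB
      · left
        have : x ∈ T := by rw [hT, Finset.mem_sdiff]; exact ⟨hx, hxB⟩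
        rw [hTz] at this
        exact Finset.mem_singleton.1 this
    · rintro (rfl | hx)
      · exact hzL
      · exact hBL hx
  -- the complement rank, in ℕ∞ and in ℕ
  have hpfin : M.eRk ((gr M \ B : Finset α) : Set α) ≠ ⊤ := by
    rw [← lt_top_iff_ne_top]; exact (M.isRkFinite_set _).eRk_lt_top
  have hpE : M.eRk ((gr M \ B : Finset α) : Set α) = (p : ℕ∞) := by
    rw [hpdef]; unfold crk; rw [ENat.coe_toNat hpfin]
  have hTj : M.eRk ((T : Finset α) : Set α) ≤ (1 : ℕ∞) := by
    have := eRk_clF_sdiff_le_jB hBg hB2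
    rw [hj] at this
    exact_mod_cast this
  have hF1 : (p : ℕ∞) ≤ M.eRk ((F : Finset α) : Set α) + 1 := by
    rw [← hpE, hFT, Finset.coe_union]
    calc M.eRk ((F : Finset α) ∪ (T : Finset α) : Set α) ≤ M.eRk (F : Set α) + M.eRk (T : Set α) :=
          M.eRk_union_le_eRk_add_eRk _ _
      _ ≤ M.eRk (F : Set α) + 1 := add_le_add_right hTj _
  have hFcard : M.eRk ((F : Finset α) : Set α) ≤ (F.card : ℕ∞) := by
    rw [← Set.encard_coe_eq_coe_finsetCard]; exact M.eRk_le_encard _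
  have hF2 : p ≤ F.card + 1 := by
    have : (p : ℕ∞) ≤ (F.card : ℕ∞) + 1 := hF1.trans (add_le_add_left hFcard _)
    exact_mod_cast this
  -- the points of F are outside the line
  have hFmem : ∀ y ∈ F, y ∈ gr M ∧ y ∉ L ∧ y ∉ B ∧ y ≠ z := by
    intro y hy
    rw [hF, Finset.mem_sdiff] at hy
    refine ⟨hy.1, hy.2, fun h => hy.2 (hBL h), ?_⟩
    rintro rfl; exact hy.2 hzL
  have hycl : ∀ y ∈ F, y ∉ M.closure (B : Set α) := by
    intro y hy h
    exact (hFmem y hy).2.1 (by rw [hL, ← Finset.mem_coe, coe_clF]; exact h)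
  -- the one-extra-point supersets B ∪ {y}
  have hmem1 : ∀ y ∈ F, insert y B ∈ (Shadow.levelSet M 3).filter (fun S => B ⊆ S) := by
    intro y hy
    have hyE : y ∈ M.E := by rw [← coe_gr]; exact_mod_cast (hFmem y hy).1
    rw [Finset.mem_filter, Profile.mem_levelSet]
    refine ⟨⟨Finset.insert_subset (hFmem y hy).1 hBg, ?_⟩, Finset.subset_insert _ _⟩
    rw [Finset.coe_insert, M.eRk_insert_eq_add_one ⟨hyE, hycl y hy⟩, hB2]; rfl
  have hinj1 : Set.InjOn (fun y => insert y B) (F : Set α) := by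
    intro y hy y' hy' h
    simp only at h
    rw [Finset.mem_coe] at hy hy'
    have : y ∈ insert y' B := by rw [← h]; exact Finset.mem_insert_self _ _
    rw [Finset.mem_insert] at this
    rcases this with h' | h'
    · exact h'
    · exact absurd h' (hFmem y hy).2.2.1
  have hval1 : ∀ y ∈ F, w4n M B (insert y B) = 1 := by
    intro y hy
    have hsd : (insert y B \ B).card = 1 := by
      rw [Finset.insert_sdiff_of_notMem _ (hFmem y hy).2.2.1, Finset.sdiff_self, Finset.insert_empty,
        Finset.card_singleton]
    have hw : w4 M B (insert y B) = 1 := by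
      unfold w4
      simp only
      rw [if_neg (by omega : ¬ crk M B < 3), if_pos hsd, if_neg (by omega : ¬ 3 ≤ B.card),
        if_neg (by rw [hj]; exact one_ne_zero), if_pos hj]
    unfold w4n
    rw [hw, max_eq_right zero_le_one]
  have hsum1 : ∑ y ∈ F, w4n M B (insert y B) = (F.card : ℚ) := by
    rw [Finset.sum_congr rfl hval1, Finset.sum_const, nsmul_eq_mul, mul_one]
  rcases le_or_gt p F.card with hbig | hsmall
  · -- |F| ≥ p: the one-extra-point supersets alone pay p
    have hsub : F.image (fun y => insert y B) ⊆ (Shadow.levelSet M 3).filter (fun S => B ⊆ S) := by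
      intro S hS; rw [Finset.mem_image] at hS; obtain ⟨y, hy, rfl⟩ := hS; exact hmem1 y hy
    have hlow : ∑ y ∈ F, w4n M B (insert y B) ≤
        ∑ S ∈ (Shadow.levelSet M 3).filter (fun S => B ⊆ S), w4n M B S := by
      rw [← Finset.sum_image hinj1]
      exact Finset.sum_le_sum_of_subset_of_nonneg hsub (fun S _ _ => w4n_nonneg B S)
    have : (p : ℚ) ≤ (F.card : ℚ) := by exact_mod_cast hbig
    linarith
  · -- the tight case: |F| = p − 1, F independent, the four-sets B ∪ {z, y} pay 1/(p − 1) each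
    have hFeq : F.card = p - 1 := by omega
    have hFind : M.Indep (F : Set α) := by
      rw [Matroid.indep_iff_eRk_eq_encard_of_finite (Finset.finite_toSet F)]
      apply le_antisymm (M.eRk_le_encard _)
      rw [Set.encard_coe_eq_coe_finsetCard]
      have h1 : ((F.card : ℕ) : ℕ∞) + 1 ≤ M.eRk (F : Set α) + 1 := by
        have hpj : ((F.card : ℕ) : ℕ∞) + 1 = (p : ℕ∞) := by
          rw [hFeq]; norm_cast; omega
        rw [hpj]; exact hF1
      exact WithTop.add_le_add_iff_right (ENat.coe_ne_top 1) |>.1 h1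
    -- the four-sets
    have hzcl : z ∉ M.closure ((insert z B : Finset α) : Set α) → False := by
      intro h
      exact h (M.subset_closure _ (by rw [← coe_gr]; exact_mod_cast Finset.insert_subset hzg hBg)
        (by exact_mod_cast Finset.mem_insert_self z B))
    have hLrank : M.eRk ((insert z B : Finset α) : Set α) = 2 := by
      rw [← hLeq, hL]; exact eRk_clF_of_eRk_two hB2
    have hmem2 : ∀ y ∈ F, insert y (insert z B) ∈ (Shadow.levelSet M 3).filter (fun S => B ⊆ S) := by
      intro y hy
      have hyE : y ∈ M.E := by rw [← coe_gr]; exact_mod_cast (hFmem y hy).1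
      have hycl' : y ∉ M.closure ((insert z B : Finset α) : Set α) := by
        rw [← hLeq, hL, coe_clF, M.closure_closure]
        exact hycl y hy
      rw [Finset.mem_filter, Profile.mem_levelSet]
      refine ⟨⟨Finset.insert_subset (hFmem y hy).1 (Finset.insert_subset hzg hBg), ?_⟩,
        (Finset.subset_insert _ _).trans (Finset.subset_insert _ _)⟩
      rw [Finset.coe_insert, M.eRk_insert_eq_add_one ⟨hyE, hycl'⟩, hLrank]; rfl
    have hinj2 : Set.InjOn (fun y => insert y (insert z B)) (F : Set α) := by
      intro y hy y' hy' h
      simp only at h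
      rw [Finset.mem_coe] at hy hy'
      have : y ∈ insert y' (insert z B) := by rw [← h]; exact Finset.mem_insert_self _ _
      rw [Finset.mem_insert, Finset.mem_insert] at this
      rcases this with h' | h' | h'
      · exact h'
      · exact absurd h' (hFmem y hy).2.2.2
      · exact absurd h' (hFmem y hy).2.2.1
    have hval2 : ∀ y ∈ F, w4n M B (insert y (insert z B)) = 1 / ((p : ℚ) - 1) := by
      intro y hy
      obtain ⟨hyg, hyL, hyB, hyz⟩ := hFmem y hy
      have hsd : (insert y (insert z B) \ B).card = 2 := by
        rw [Finset.insert_sdiff_of_notMem _ hyB, Finset.insert_sdiff_of_notMem _ hzB, Finset.sdiff_self,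
          Finset.insert_empty, Finset.card_pair hyz]
      -- the complement of the four-set is F ∖ {y}
      have hcompl : gr M \ insert y (insert z B) = F.erase y := by
        ext x
        simp only [Finset.mem_sdiff, Finset.mem_insert, Finset.mem_erase, not_or]
        constructor
        · rintro ⟨hx, hxy, hxz, hxB⟩
          refine ⟨hxy, ?_⟩
          rw [hF, Finset.mem_sdiff, hLeq, Finset.mem_insert]
          exact ⟨hx, by tauto⟩
        · rintro ⟨hxy, hxF⟩
          obtain ⟨hxg, _, hxB, hxz⟩ := hFmem x hxF
          exact ⟨hxg, hxy, hxz, hxB⟩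
      have hrfin : M.eRk ((gr M \ insert y (insert z B) : Finset α) : Set α) ≠ ⊤ := by
        rw [← lt_top_iff_ne_top]; exact (M.isRkFinite_set _).eRk_lt_top
      have hr : M.eRk ((gr M \ insert y (insert z B) : Finset α) : Set α) = ((p - 2 : ℕ) : ℕ∞) := by
        rw [hcompl, (hFind.subset (Finset.coe_subset.2 (Finset.erase_subset _ _))).eRk_eq_encard,
          Set.encard_coe_eq_coe_finsetCard, Finset.card_erase_of_mem hy, hFeq]
        norm_cast
      have hrN : crk M (insert y (insert z B)) = p - 2 := by
        unfold crk; rw [hr, ENat.toNat_coe]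
      have hw : w4 M B (insert y (insert z B)) = 1 / ((p : ℚ) - 1) := by
        unfold w4
        simp only
        rw [if_neg (by omega : ¬ crk M B < 3), if_neg (by omega : ¬ (insert y (insert z B) \ B).card = 1),
          if_pos ⟨hsd, hBc⟩, if_pos ⟨hj, by rw [hrN]; omega⟩]
      unfold w4n
      rw [hw, max_eq_right]
      apply div_nonneg zero_le_one
      have : (3 : ℚ) ≤ (p : ℚ) := by exact_mod_cast hp
      linarith
    -- the two families are disjoint and both lie in the filter
    have hdisj : Disjoint (F.image (fun y => insert y B)) (F.image (fun y => insert y (insert z B))) := by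
      rw [Finset.disjoint_left]
      intro S hS1 hS2
      rw [Finset.mem_image] at hS1 hS2
      obtain ⟨y, hy, rfl⟩ := hS1
      obtain ⟨y', hy', hh⟩ := hS2
      have hc1 : (insert y B).card = 3 := by
        rw [Finset.card_insert_of_notMem (hFmem y hy).2.2.1, hBc]
      have hc2 : (insert y' (insert z B)).card = 4 := by
        rw [Finset.card_insert_of_notMem, Finset.card_insert_of_notMem hzB, hBc]
        rw [Finset.mem_insert, not_or]
        exact ⟨(hFmem y' hy').2.2.2, (hFmem y' hy').2.2.1⟩
      rw [hh] at hc2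
      omega
    have hsub : F.image (fun y => insert y B) ∪ F.image (fun y => insert y (insert z B)) ⊆
        (Shadow.levelSet M 3).filter (fun S => B ⊆ S) := by
      intro S hS
      rw [Finset.mem_union, Finset.mem_image, Finset.mem_image] at hS
      rcases hS with ⟨y, hy, rfl⟩ | ⟨y, hy, rfl⟩
      · exact hmem1 y hy
      · exact hmem2 y hy
    have hlow : ∑ y ∈ F, w4n M B (insert y B) + ∑ y ∈ F, w4n M B (insert y (insert z B)) ≤
        ∑ S ∈ (Shadow.levelSet M 3).filter (fun S => B ⊆ S), w4n M B S := by
      rw [← Finset.sum_image hinj1, ← Finset.sum_image hinj2, ← Finset.sum_union hdisj]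
      exact Finset.sum_le_sum_of_subset_of_nonneg hsub (fun S _ _ => w4n_nonneg B S)
    have hsum2 : ∑ y ∈ F, w4n M B (insert y (insert z B)) = 1 := by
      rw [Finset.sum_congr rfl hval2, Finset.sum_const, nsmul_eq_mul]
      have hFq : (F.card : ℚ) = (p : ℚ) - 1 := by
        rw [hFeq, Nat.cast_sub (by omega)]; push_cast; ring
      have hpos : (p : ℚ) - 1 ≠ 0 := by
        have : (3 : ℚ) ≤ (p : ℚ) := by exact_mod_cast hp
        linarith
      rw [hFq]; field_simp
    have hFq : (F.card : ℚ) = (p : ℚ) - 1 := by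
      rw [hFeq, Nat.cast_sub (by omega)]; push_cast; ring
    rw [hsum1, hsum2, hFq] at hlow
    linarith

end DemC

end PercRepro
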